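import Summits.Ventures.YMGap.RobustBall.LoopDirectionS
import HarnessLib

/-!
# Venture YMGap, track ROBUST-BALL (Y2) — loop-coupling directions, PER-LOOP FORM: `d/ds ⟨F⟩ = −Σ_i cov(F, c_i Re tr U_{γ_i}/N)`

HONEST FRAMING. WHAT THIS IS: a venture file (cell `pub-ymgap`, track Y2 ROBUST-BALL, seat rb-p1, theorems only): the reindexing of
`LoopDirectionS.hasDerivAt_integral_loopDirection_S` from link sets to LOOPS.  The per-loop susceptibility series
`i ↦ cov_μ(F, c_i Re tr U_{γ_i}/N)` is absolutely summable uniformly on the ball (`summable_cov_loopTerm_S`), the carrier fibres are finite, so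
`Σ'_X cov(F, (loopFamilyAction N γ c)_X) = Σ'_i cov(F, loopTerm N c_i γ_i)` (`tsum_cov_loopFamilyAction_eq`, Mathlib `HasSum.tsum_fiberwise`), and
* ★ `hasDerivAt_integral_loopDirection_perLoop_S` — `d/ds ∫ F dν(s) = −Σ'_i cov_{ν(s)}(F, c_i Re tr U_{γ_i}/N)` at every `|s| < s₀`, for every
  selection `ν(s) ∈ 𝒢(W + s·loopFamilyAction N γ c)`: the response of the state to a family of Wilson-loop sources is the sum over the loops of
  the loop susceptibilities;
* `su2_wilson_hasDerivAt_integral_loopDirection_perLoop` — the `SU(2)` Wilson point on `ℤ⁴`.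
WHAT THIS IS NOT: anything beyond `LoopDirectionS` mathematically; lattice strong coupling; nothing about the continuum limit or a Clay-sense gap.
-/

noncomputable section

open MeasureTheory Function Finset ProbabilityTheory Real Filter Topology
open scoped NNReal
open Literature.Probability.LatticeModels
open Literature.Probability.LatticeModels.DobrushinMetric
open Literature.MathematicalPhysics.QuantumLattice
open Literature.MathematicalPhysics.QuantumFieldTheory hiding ZdEdge
open Summit.QuantumFields.BalabanUV.InfraRed.StrongCouplingPoincareDoorSUN (oneLinkPoincareSUN_two_sharp)

namespace Summit.Ventures.YMGap.RobustBall

variable {d N : ℕ} {ι : Type*} {γ : ι → ZdLoop d} {c : ι → ℝ} {ε : ℝ}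

/-- **Reindexing from link sets to loops**: with finite carrier fibres and a summable per-loop covariance family,
`Σ'_X cov_μ(F, (loopFamilyAction N γ c)_X) = Σ'_i cov_μ(F, loopTerm N c_i γ_i)`. -/
theorem tsum_cov_loopFamilyAction_eq (hfin : ∀ X, {i | walkEdges (γ i).walk = X}.Finite)
    {μ : Measure (LGConfig d (Matrix.specialUnitaryGroup (Fin N) ℂ))} [IsProbabilityMeasure μ]
    {F : LGConfig d (Matrix.specialUnitaryGroup (Fin N) ℂ) → ℝ} (hFm : Measurable F) {MF : ℝ} (hMF : ∀ σ, |F σ| ≤ MF)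
    (hs : Summable fun i : ι => cov[F, loopTerm (d := d) N (c i) (γ i).walk; μ]) :
    ∑' X : Finset (ZdEdge d), cov[F, loopFamilyAction (d := d) N γ c X; μ] =
      ∑' i : ι, cov[F, loopTerm (d := d) N (c i) (γ i).walk; μ] := by
  classical
  have hfib := mem_carrierFib hfin
  have hF2 : MemLp F 2 μ :=
    MemLp.of_bound hFm.aestronglyMeasurable MF (Eventually.of_forall fun σ => by rw [Real.norm_eq_abs]; exact hMF σ)
  have hX : ∀ X : Finset (ZdEdge d), cov[F, loopFamilyAction (d := d) N γ c X; μ] =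
      ∑ i ∈ carrierFib (fun i => walkEdges (γ i).walk) X, cov[F, loopTerm (d := d) N (c i) (γ i).walk; μ] := by
    intro X
    have hφ2 : ∀ i ∈ carrierFib (fun i => walkEdges (γ i).walk) X, MemLp (loopTerm (d := d) N (c i) (γ i).walk) 2 μ :=
      fun i _ => MemLp.of_bound (continuous_loopTerm (c := c i) (γ i).walk).measurable.aestronglyMeasurable |c i|
        (Eventually.of_forall fun σ => by rw [Real.norm_eq_abs]; exact abs_loopTerm_le (γ i).walk σ)
    have hfun : loopFamilyAction (d := d) N γ c X = fun U => ∑ i ∈ carrierFib (fun i => walkEdges (γ i).walk) X,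
        loopTerm (d := d) N (c i) (γ i).walk U := by
      funext U; simp [loopFamilyAction]
    rw [hfun, covariance_fun_sum_right' hφ2 hF2]
  have hfibre : ∀ X : Finset (ZdEdge d),
      ∑' b : ((fun i => walkEdges (γ i).walk) ⁻¹' {X} : Set ι), cov[F, loopTerm (d := d) N (c b) (γ b).walk; μ] =
        ∑ i ∈ carrierFib (fun i => walkEdges (γ i).walk) X, cov[F, loopTerm (d := d) N (c i) (γ i).walk; μ] := by
    intro X
    have hset : ((fun i => walkEdges (γ i).walk) ⁻¹' {X} : Set ι) = ↑(carrierFib (fun i => walkEdges (γ i).walk) X) := by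
      ext i; simp only [Set.mem_preimage, Set.mem_singleton_iff, Finset.mem_coe, hfib X i]
    rw [hset]
    exact Finset.tsum_subtype' (carrierFib (fun i => walkEdges (γ i).walk) X)
      (fun i : ι => cov[F, loopTerm (d := d) N (c i) (γ i).walk; μ])
  have hfw := hs.hasSum.tsum_fiberwise fun i => walkEdges (γ i).walk
  calc ∑' X : Finset (ZdEdge d), cov[F, loopFamilyAction (d := d) N γ c X; μ]
      = ∑' X : Finset (ZdEdge d), ∑' b : ((fun i => walkEdges (γ i).walk) ⁻¹' {X} : Set ι),
          cov[F, loopTerm (d := d) N (c b) (γ b).walk; μ] := tsum_congr fun X => by rw [hX X, hfibre X]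
    _ = ∑' i : ι, cov[F, loopTerm (d := d) N (c i) (γ i).walk; μ] := hfw.tsum_eq

section Derivative

variable {W : Potential (ZdEdge d) (Matrix.specialUnitaryGroup (Fin N) ℂ)}

/-- ★ **PER-LOOP FORM: the derivative along a loop-coupling direction is the sum over the LOOPS of the loop susceptibilities.**  Hypotheses
as in `hasDerivAt_integral_loopDirection_S`; conclusion: at every `|s| < s₀`,
`HasDerivAt (s ↦ ∫ F dν(s)) (−Σ'_i cov_{ν(s)}(F, loopTerm N c_i γ_i)) s` (and that series is summable). -/
theorem hasDerivAt_integral_loopDirection_perLoop_S (hd : 1 ≤ d) (hN : 1 ≤ N) {β b cc v a' Λ' t : ℝ}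
    (hc : 0 ≤ cc) (hv : 0 ≤ v) (hb : |β| * (2 * ((d : ℝ) - 1)) ≤ b)
    (hP : ∀ B : Matrix (Fin N) (Fin N) ℂ, matrixOpNorm B ≤ b →
      ∀ (ψ : Matrix.specialUnitaryGroup (Fin N) ℂ → ℝ) (M : ℝ), 0 ≤ M →
        (∀ x y, |ψ x - ψ y| ≤ M * suFrobDist x y) →
        Var[ψ; (haarProbability (Matrix.specialUnitaryGroup (Fin N) ℂ)).tilted
          fun g => (N : ℝ) * ((g : Matrix (Fin N) (Fin N) ℂ) * B).trace.re] ≤ cc * M ^ 2)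
    (hVB : ∀ B : Matrix (Fin N) (Fin N) ℂ, matrixOpNorm B ≤ b → ∀ Δ : Matrix (Fin N) (Fin N) ℂ,
      Var[fun g : Matrix.specialUnitaryGroup (Fin N) ℂ =>
          (N : ℝ) * ((g : Matrix (Fin N) (Fin N) ℂ) * Δ).trace.re;
        (haarProbability (Matrix.specialUnitaryGroup (Fin N) ℂ)).tilted
          fun g => (N : ℝ) * ((g : Matrix (Fin N) (Fin N) ℂ) * B).trace.re] ≤ v * frobNorm Δ ^ 2)
    (ht : 0 < t) (hρ : 6 * ((d : ℝ) - 1) * |β| * (exp a' * exp t * Real.sqrt (cc * v)) + exp (a' / 2) * Real.sqrt cc * Λ' < 1)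
    {a Λ s₀ : ℝ} (hW : MemBallZdS a Λ t W) (hfin : ∀ X, {i | walkEdges (γ i).walk = X}.Finite) (hnorm : LoopNormLE t γ c ε)
    (hs₀ : 0 < s₀) (ha' : a + s₀ * (2 * ε) ≤ a') (hΛ' : Λ + s₀ * ε ≤ Λ')
    {ν : ℝ → Measure (LGConfig d (Matrix.specialUnitaryGroup (Fin N) ℂ))}
    (hν : ∀ s ∈ Set.Icc (-s₀) s₀, ν s ∈ perturbedGibbsMeasuresS (d := d) (fundamentalRep (Fin N)) (N * β)
      (W + s • loopFamilyAction (d := d) N γ c))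
    {F : LGConfig d (Matrix.specialUnitaryGroup (Fin N) ℂ) → ℝ} (hFm : Measurable F) {ΛF : Finset (ZdEdge d)}
    (hFdep : DependsOn F (↑ΛF : Set (ZdEdge d))) {MF : ℝ} (hMF : ∀ σ, |F σ| ≤ MF) {δF : ZdEdge d → ℝ}
    (hδF : IsLipBound suFrobDist F δF) {s : ℝ} (hs : s ∈ Set.Ioo (-s₀) s₀) :
    Summable (fun i : ι => cov[F, loopTerm (d := d) N (c i) (γ i).walk; ν s]) ∧
      HasDerivAt (fun s => ∫ U, F U ∂(ν s)) (-(∑' i : ι, cov[F, loopTerm (d := d) N (c i) (γ i).walk; ν s])) s := by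
  have hsJ : s ∈ Set.Icc (-s₀) s₀ := Set.Ioo_subset_Icc_self hs
  have habs : |s| ≤ s₀ := abs_le.2 ⟨by linarith [hsJ.1], hsJ.2⟩
  -- the member `W + s·V` at the bigger loads and its state
  have hV : MemBallZdS (2 * ε) ε t (loopFamilyAction (d := d) N γ c) := memBallZdS_loopFamilyAction hfin hnorm
  have hε : 0 ≤ ε := hnorm.nonneg
  have hmem : MemBallZdS a' Λ' t (W + s • loopFamilyAction (d := d) N γ c) :=
    (hW.add (hV.smul s)).mono ((add_le_add le_rfl (mul_le_mul_of_nonneg_right habs (by positivity))).trans ha')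
      ((add_le_add le_rfl (mul_le_mul_of_nonneg_right habs hε)).trans hΛ')
  haveI : IsProbabilityMeasure (ν s) := (show IsGibbsMeasure _ _ from hν s hsJ).isProbabilityMeasure
  have hsum := summable_cov_loopTerm_S (γ := γ) (c := c) hd hN hc hv hb hP hVB ht hρ hmem hnorm (hν s hsJ) hFm hFdep hMF hδF
  have hder := (hasDerivAt_integral_loopDirection_S hd hN hc hv hb hP hVB ht hρ hW hfin hnorm hs₀ ha' hΛ' hν hFm hFdep hMF hδF).1 s hs
  rw [tsum_cov_loopFamilyAction_eq hfin hFm hMF hsum] at hder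
  exact ⟨hsum, hder⟩

end Derivative

-- build-lane headroom (the hub build lane runs ≈ 10–20 % hungrier than the check farm; cf. ops-buildfix p384078): this cell elaborates at the
-- default budget on the farm but within 20 % of it.
set_option maxHeartbeats 400000 in
/-- **THE `SU(2)` WILSON POINT ON `ℤ⁴`, PER-LOOP FORM.**  `0 < t`, `0 < s₀`, loop family with finite fibres and `‖c‖_t ≤ ε`,
`6|β_W| e^{2s₀ε} e^{t} + e^{s₀ε} √(2/3) s₀ε < 1`: for every selection `ν(s) ∈ 𝒢(Wilson + s·loopFamilyAction 2 γ c)` (bare coupling `β_W/2`)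
on `|s| ≤ s₀` and every Lipschitz cylinder `F`, at every `|s| < s₀`: the per-loop susceptibilities are summable and
`d/ds ∫ F dν(s) = −Σ'_i cov_{ν(s)}(F, c_i Re tr U_{γ_i}/2)`. -/
theorem su2_wilson_hasDerivAt_integral_loopDirection_perLoop {ι : Type*} {γ : ι → ZdLoop 4} {c : ι → ℝ} {βW t s₀ ε : ℝ}
    (ht : 0 < t) (hs₀ : 0 < s₀)
    (hρ : 6 * |βW| * (exp (s₀ * (2 * ε)) * exp t) + exp (s₀ * (2 * ε) / 2) * Real.sqrt (2 / 3) * (s₀ * ε) < 1)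
    (hfin : ∀ X, {i | walkEdges (γ i).walk = X}.Finite) (hnorm : LoopNormLE t γ c ε)
    {ν : ℝ → Measure (LGConfig 4 (Matrix.specialUnitaryGroup (Fin 2) ℂ))}
    (hν : ∀ s ∈ Set.Icc (-s₀) s₀, ν s ∈ perturbedGibbsMeasuresS (d := 4) (fundamentalRep (Fin 2)) (2 * (βW / 4))
      (0 + s • loopFamilyAction (d := 4) 2 γ c))
    {F : LGConfig 4 (Matrix.specialUnitaryGroup (Fin 2) ℂ) → ℝ} {ΛF : Finset (ZdEdge 4)} {KF : ℝ≥0}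
    (hF : IsLipschitzCylinder (fundamentalRep (Fin 2)) F ΛF KF) {s : ℝ} (hs : s ∈ Set.Ioo (-s₀) s₀) :
    Summable (fun i : ι => cov[F, loopTerm (d := 4) 2 (c i) (γ i).walk; ν s]) ∧
      HasDerivAt (fun s => ∫ U, F U ∂(ν s)) (-(∑' i : ι, cov[F, loopTerm (d := 4) 2 (c i) (γ i).walk; ν s])) s := by
  have hc : (0 : ℝ) ≤ 2 / 3 := by norm_num
  have hP : ∀ B : Matrix (Fin 2) (Fin 2) ℂ, matrixOpNorm B ≤ |βW / 4| * (2 * (((4 : ℕ) : ℝ) - 1)) →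
      ∀ (ψ : Matrix.specialUnitaryGroup (Fin 2) ℂ → ℝ) (M : ℝ), 0 ≤ M →
        (∀ x y, |ψ x - ψ y| ≤ M * suFrobDist x y) →
        Var[ψ; (haarProbability (Matrix.specialUnitaryGroup (Fin 2) ℂ)).tilted
          fun g => ((2 : ℕ) : ℝ) * ((g : Matrix (Fin 2) (Fin 2) ℂ) * B).trace.re] ≤ 2 / 3 * M ^ 2 :=
    fun B hB ψ M hM hψ => oneLinkPoincareSUN_two_sharp _ B hB ψ M hM hψ
  have hVB := linVariance_of_poincare (N := 2) hP
  have hv : (0 : ℝ) ≤ 2 / 3 * ((2 : ℕ) : ℝ) ^ 2 := by norm_num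
  have hsq : Real.sqrt (2 / 3 * (2 / 3 * ((2 : ℕ) : ℝ) ^ 2)) = 4 / 3 := by
    rw [show (2 / 3 * (2 / 3 * ((2 : ℕ) : ℝ) ^ 2) : ℝ) = (4 / 3) ^ 2 by norm_num, Real.sqrt_sq (by norm_num)]
  have hρ' : 6 * (((4 : ℕ) : ℝ) - 1) * |βW / 4| * (exp (s₀ * (2 * ε)) * exp t * Real.sqrt (2 / 3 * (2 / 3 * ((2 : ℕ) : ℝ) ^ 2))) +
      exp (s₀ * (2 * ε) / 2) * Real.sqrt (2 / 3) * (s₀ * ε) < 1 := by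
    rw [hsq, abs_div, abs_of_pos (by norm_num : (0 : ℝ) < 4)]
    have : 6 * (((4 : ℕ) : ℝ) - 1) * (|βW| / 4) * (exp (s₀ * (2 * ε)) * exp t * (4 / 3)) = 6 * |βW| * (exp (s₀ * (2 * ε)) * exp t) := by
      norm_num; ring
    rw [this]; exact hρ
  have hν' : ∀ s ∈ Set.Icc (-s₀) s₀, ν s ∈ perturbedGibbsMeasuresS (d := 4) (fundamentalRep (Fin 2)) ((2 : ℕ) * (βW / 4))
      (0 + s • loopFamilyAction (d := 4) 2 γ c) := fun s hs => by simpa using hν s hs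
  have hA : ∀ a b : Matrix.specialUnitaryGroup (Fin 2) ℂ, dist (suEntries a) (suEntries b) ≤ 1 * suFrobDist a b :=
    fun a b => by rw [one_mul]; exact dist_suEntries_le_suFrobDist a b
  exact hasDerivAt_integral_loopDirection_perLoop_S (N := 2) (d := 4) (by norm_num) (by norm_num) hc hv le_rfl hP hVB ht hρ'
    (memBallZdS_zero le_rfl le_rfl) hfin hnorm hs₀ (by simp) (by simp) hν' hF.measurable hF.dependsOn hF.abs_le
    (hF.isLipBound zero_le_one hA) hs

end Summit.Ventures.YMGap.RobustBall

end
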